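import Summits.KontsevichZagierPeriods.KontsevichZagierPeriods.Theorems.EllipticMomentKernel.Negative.GeneralCurve
import Literature.NumberTheory.Transcendental.KZSemialgebraicComplex

/-!
# `EllipticMomentKernel` (stmt-KontsevichZagierPeriods-10631) — negative knowledge, part 9a: vertical descent is ONE legal rule-3 move for every admissible parameter

Standing-adversary certificate for the registered skeleton's stub `stub_verticalDescent` (line
`hermite-coordinates-hom`): it cannot be broken because it is TRUE, and here is the sorry-free
proof for every rational cubic with `disc > 0` and every moment `x^a y^b`. The Newton–Leibniz move
is taken in the one shape not previously instantiated anywhere in the tree — base of POSITIVE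
dimension (the open oval `σ ⊆ ℝ¹`), VARIABLE upper bound `b(x) = √f(x)`, band
`vBand = {x ∈ σ, 0 ≤ y ≤ √f(x)} ⊆ ℝ²` in the literal `Fin.init/Fin.last` form — with the polynomial
primitive `x^a y^{b+1}/(b+1)`: `of_vBandRep_sub_of_vBaseRep_mem_newtonLeibnizRel`. The passage from
the closed band to the open region `D = underGraph` is ONE domain-additivity move across the two
null graphs `y = 0`, `y = √f(x)` (`vEnds`, null by Tonelli: `volume_graph_eq_zero`), whence
`verticalDescent : ∃ s, s.domain = σ ∧ s.integrand = x^a √f^{b+1}/(b+1) on σ ∧ [r] − [s] ∈ relations`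
for every representation `r` of `[D, x^a y^b]` — the stub with its decorative hypothesis
`hσ : IsSemialgebraic ℚ σ` dropped. By part 3 (`DimEval`) no derivation of this congruence avoids
rule 3. [folklore]
-/

noncomputable section

open MeasureTheory Set
open scoped BigOperators

namespace Summit.KontsevichZagierPeriods.HermiteRigidity.EllipticMomentKernelNegative

open Literature.NumberTheory.Transcendental
open Literature.NumberTheory.Transcendental.KZ

section VerticalDescent

open Literature.ModelTheory.ExponentialFields (IsSemialgebraic isSemialgebraic_setOf_eval_pos
  isSemialgebraic_setOf_eval_eq_zero isSemialgebraic_univ)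
open MvPolynomial (aeval X C)

variable {q₂ q₃ : ℚ}

/-- The upper bound of the vertical band: `b(x) = √f(x)` on `ℝ¹`. [folklore] -/
def sqrtCubic (q₂ q₃ : ℚ) (x : Fin 1 → ℝ) : ℝ := Real.sqrt (cubic q₂ q₃ (x 0))

/-- The CLOSED vertical band over the oval, in the literal shape of `KZ.newtonLeibnizRel` with base
`σ ⊆ ℝ¹` (open!) and the variable bounds `a = 0 ≤ b = √f`:
`{z ∈ ℝ² | init z ∈ σ, 0 ≤ z_last ≤ √f((init z)₀)}`. [folklore] -/
def vBand (q₂ q₃ : ℚ) : Set (Fin 2 → ℝ) :=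
  {z | (Fin.init z : Fin 1 → ℝ) ∈ oval q₂ q₃ ∧ (fun _ => (0 : ℝ)) (Fin.init z) ≤ z (Fin.last 1) ∧
    z (Fin.last 1) ≤ sqrtCubic q₂ q₃ (Fin.init z)}

/-- `Fin.init` on `ℝ²`: the first coordinate. [folklore] -/
theorem init_apply_zero (z : Fin 2 → ℝ) : (Fin.init z : Fin 1 → ℝ) 0 = z 0 := rfl

/-- `Fin.snoc` on `ℝ¹ → ℝ²`: first coordinate. [folklore] -/
theorem snoc₂_apply_zero (x : Fin 1 → ℝ) (t : ℝ) : (Fin.snoc x t : Fin 2 → ℝ) 0 = x 0 := rfl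

/-- `Fin.snoc` on `ℝ¹ → ℝ²`: last coordinate. [folklore] -/
theorem snoc₂_apply_one (x : Fin 1 → ℝ) (t : ℝ) : (Fin.snoc x t : Fin 2 → ℝ) 1 = t := rfl

/-- The vertical band, coordinate-wise: `{(x, y) | x ∈ σ, 0 ≤ y ≤ √f(x)}`. [folklore] -/
theorem mem_vBand_iff (z : Fin 2 → ℝ) :
    z ∈ vBand q₂ q₃ ↔ (Fin.init z : Fin 1 → ℝ) ∈ oval q₂ q₃ ∧ 0 ≤ z 1 ∧
      z 1 ≤ Real.sqrt (cubic q₂ q₃ (z 0)) := Iff.rfl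

/-- The general cubic as a `ℚ`-polynomial in the first of two variables. [folklore] -/
def cubicPoly₂ (q₂ q₃ : ℚ) : MvPolynomial (Fin 2) ℚ := 4 * X 0 ^ 3 - C q₂ * X 0 - C q₃

/-- Evaluation of `cubicPoly₂`. [folklore] -/
theorem aeval_cubicPoly₂ (p : Fin 2 → ℝ) : aeval p (cubicPoly₂ q₂ q₃) = cubic q₂ q₃ (p 0) := by
  simp [cubicPoly₂, cubic, map_ofNat]

/-- **The vertical band is `ℚ`-semialgebraic** (quantifier-free: cylinder over `σ`, `0 ≤ y`,
`y² ≤ f(x)`). [folklore] -/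
theorem isSemialgebraic_vBand (h : 0 < disc q₂ q₃) : IsSemialgebraic ℚ (vBand q₂ q₃) := by
  have h1 : IsSemialgebraic ℚ {z : Fin 2 → ℝ | (Fin.init z : Fin 1 → ℝ) ∈ oval q₂ q₃} :=
    (isSemialgebraic_oval h).setOf_init_mem
  have h2 : IsSemialgebraic ℚ {z : Fin 2 → ℝ | 0 ≤ z 1} := by
    have ha := isSemialgebraic_setOf_eval_pos (k := ℚ) (R := ℝ) (X 1 : MvPolynomial (Fin 2) ℚ)
    have hb := isSemialgebraic_setOf_eval_eq_zero (k := ℚ) (R := ℝ) (X 1 : MvPolynomial (Fin 2) ℚ)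
    convert ha.union hb using 1
    ext z
    simp only [mem_setOf_eq, mem_union, MvPolynomial.aeval_X]
    constructor
    · intro hz
      rcases hz.lt_or_eq with hz | hz
      · exact Or.inl hz
      · exact Or.inr hz.symm
    · rintro (hz | hz)
      · exact hz.le
      · exact hz.ge
  have h3 : IsSemialgebraic ℚ {z : Fin 2 → ℝ | z 1 ^ 2 ≤ cubic q₂ q₃ (z 0)} := by
    have ha := isSemialgebraic_setOf_eval_pos (k := ℚ) (R := ℝ)
      (cubicPoly₂ q₂ q₃ - X 1 ^ 2 : MvPolynomial (Fin 2) ℚ)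
    have hb := isSemialgebraic_setOf_eval_eq_zero (k := ℚ) (R := ℝ)
      (cubicPoly₂ q₂ q₃ - X 1 ^ 2 : MvPolynomial (Fin 2) ℚ)
    convert ha.union hb using 1
    ext z
    simp only [mem_setOf_eq, mem_union, map_sub, map_pow, MvPolynomial.aeval_X, aeval_cubicPoly₂]
    constructor
    · intro hz
      rcases hz.lt_or_eq with hz | hz
      · exact Or.inl (by linarith)
      · exact Or.inr (by linarith)
    · rintro (hz | hz)
      · linarith
      · linarith
  convert h1.inter (h2.inter h3) using 1
  ext z
  simp only [mem_vBand_iff, mem_inter_iff, mem_setOf_eq]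
  constructor
  · rintro ⟨hσ, h0, hle⟩
    refine ⟨hσ, h0, ?_⟩
    have hf : 0 ≤ cubic q₂ q₃ (z 0) := hσ.1.le
    calc z 1 ^ 2 ≤ Real.sqrt (cubic q₂ q₃ (z 0)) ^ 2 := by gcongr
      _ = cubic q₂ q₃ (z 0) := Real.sq_sqrt hf
  · rintro ⟨hσ, h0, hle⟩
    exact ⟨hσ, h0, (Real.le_sqrt h0 hσ.1.le).2 hle⟩

/-- The vertical band lies in a compact box `[e₃, e₂] × [0, √M]`. [folklore] -/
theorem vBand_subset_Icc (h : 0 < disc q₂ q₃) :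
    ∃ lo hi : Fin 2 → ℝ, vBand q₂ q₃ ⊆ Icc lo hi := by
  obtain ⟨e₃, e₂, e₁, h3, h2a, h2b, h1, hf⟩ := exists_roots h
  have h32 : e₃ < e₂ := by linarith
  have h21 : e₂ < e₁ := by linarith
  obtain ⟨M, hM⟩ : ∃ M, ∀ x ∈ Icc e₃ e₂, cubic q₂ q₃ x ≤ M := by
    obtain ⟨M, hM⟩ := isCompact_Icc.exists_bound_of_continuousOn
      (continuous_cubic (q₂ := q₂) (q₃ := q₃)).continuousOn
    exact ⟨M, fun x hx => (le_abs_self _).trans (hM x hx)⟩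
  refine ⟨![e₃, 0], ![e₂, Real.sqrt M], fun z hz => ?_⟩
  rw [mem_vBand_iff, oval_eq_of_roots h32 h21 hf] at hz
  obtain ⟨⟨hx1, hx2⟩, h0, hle⟩ := hz
  simp only [init_apply_zero] at hx1 hx2
  rw [mem_Icc, Pi.le_def, Pi.le_def]
  refine ⟨fun i => ?_, fun i => ?_⟩ <;> fin_cases i
  · exact hx1.le
  · exact h0
  · exact hx2.le
  · exact hle.trans (Real.sqrt_le_sqrt (hM _ ⟨hx1.le, hx2.le⟩))

/-- The moment integrand `x^a y^b` is integrable on the (bounded) vertical band. [folklore] -/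
theorem integrableOn_moment_vBand (h : 0 < disc q₂ q₃) (a b : ℕ) :
    IntegrableOn (fun p : Fin 2 → ℝ => p 0 ^ a * p 1 ^ b) (vBand q₂ q₃) := by
  obtain ⟨lo, hi, hsub⟩ := vBand_subset_Icc h
  have hc : Continuous fun p : Fin 2 → ℝ => p 0 ^ a * p 1 ^ b := by fun_prop
  exact (hc.continuousOn.integrableOn_compact isCompact_Icc).mono_set hsub

/-- **The honest band representation `[vBand, x^a y^b]`** of the moment, for every admissible
parameter. [cite: KontsevichZagier2001, §1.1] -/
def vBandRep (h : 0 < disc q₂ q₃) (a b : ℕ) : IntegralRep 2 where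
  domain := vBand q₂ q₃
  integrand := fun p => p 0 ^ a * p 1 ^ b
  isSemialgebraic_domain := isSemialgebraic_vBand h
  isSemialgebraicFunOn_integrand :=
    (isSemialgebraicFunOn_aeval (isSemialgebraic_vBand h)
      (X 0 ^ a * X 1 ^ b : MvPolynomial (Fin 2) ℚ)).congr fun p _ => by simp
  integrableOn := integrableOn_moment_vBand h a b

/-- Powers of semialgebraic functions are semialgebraic. [cite: BochnakCosteRoy1998, Prop. 2.2.6] -/
theorem isSemialgebraicFunOn_pow {m : ℕ} {s : Set (Fin m → ℝ)} {g : (Fin m → ℝ) → ℝ}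
    (hs : IsSemialgebraic ℚ s) (hg : IsSemialgebraicFunOn ℚ s g) (n : ℕ) :
    IsSemialgebraicFunOn ℚ s (fun x => g x ^ n) := by
  induction n with
  | zero =>
    exact (isSemialgebraicFunOn_aeval hs (1 : MvPolynomial (Fin m) ℚ)).congr fun _ _ => by simp
  | succ n ih =>
    exact (IsSemialgebraicFunOn.mul_holds ih hg).congr fun _ _ => by simp [pow_succ]

/-- The descended integrand `x^a √f(x)^{b+1}/(b+1)` is `ℚ`-semialgebraic on `σ`. [folklore] -/
theorem isSemialgebraicFunOn_descended (h : 0 < disc q₂ q₃) (a b : ℕ) :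
    IsSemialgebraicFunOn ℚ (oval q₂ q₃)
      (fun p => p 0 ^ a * Real.sqrt (cubic q₂ q₃ (p 0)) ^ (b + 1) / ((b : ℝ) + 1)) := by
  have hs := isSemialgebraic_oval h
  have h1 : IsSemialgebraicFunOn ℚ (oval q₂ q₃)
      (fun p => aeval p (X 0 ^ a : MvPolynomial (Fin 1) ℚ)) := isSemialgebraicFunOn_aeval hs _
  have h2 : IsSemialgebraicFunOn ℚ (oval q₂ q₃) (fun p => Real.sqrt (cubic q₂ q₃ (p 0))) := by
    have := IsSemialgebraicFunOn.sqrt_holds (isSemialgebraicFunOn_aeval hs (cubicPolyQ q₂ q₃))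
    exact this.congr fun p _ => by simp [aeval_cubicPolyQ]
  have h3 := isSemialgebraicFunOn_pow hs h2 (b + 1)
  have h4 : IsSemialgebraicFunOn ℚ (oval q₂ q₃)
      (fun p => aeval p (C (1 / ((b : ℚ) + 1)) : MvPolynomial (Fin 1) ℚ)) :=
    isSemialgebraicFunOn_aeval hs _
  have h5 := IsSemialgebraicFunOn.mul_holds (IsSemialgebraicFunOn.mul_holds h1 h3) h4
  refine h5.congr fun p _ => ?_
  simp only [Pi.mul_apply, map_pow, MvPolynomial.aeval_X, MvPolynomial.aeval_C, eq_ratCast]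
  push_cast
  ring

/-- The descended integrand is integrable on `σ` (continuous, `σ` bounded). [folklore] -/
theorem integrableOn_descended (h : 0 < disc q₂ q₃) (a b : ℕ) :
    IntegrableOn (fun p : Fin 1 → ℝ => p 0 ^ a * Real.sqrt (cubic q₂ q₃ (p 0)) ^ (b + 1) /
      ((b : ℝ) + 1)) (oval q₂ q₃) := by
  obtain ⟨e₃, e₂, e₁, h3, h2a, h2b, h1, hf⟩ := exists_roots h
  have h32 : e₃ < e₂ := by linarith
  have h21 : e₂ < e₁ := by linarith
  have hsub : oval q₂ q₃ ⊆ Icc (fun _ => e₃) (fun _ => e₂) := by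
    rw [oval_eq_of_roots h32 h21 hf]
    intro p hp
    rw [mem_Icc, Pi.le_def, Pi.le_def]
    exact ⟨fun i => by fin_cases i; exact hp.1.le, fun i => by fin_cases i; exact hp.2.le⟩
  have hc : Continuous fun p : Fin 1 → ℝ => p 0 ^ a * Real.sqrt (cubic q₂ q₃ (p 0)) ^ (b + 1) /
      ((b : ℝ) + 1) := by
    have : Continuous fun p : Fin 1 → ℝ => cubic q₂ q₃ (p 0) :=
      continuous_cubic.comp (continuous_apply 0)
    fun_prop
  exact (hc.continuousOn.integrableOn_compact isCompact_Icc).mono_set hsub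

/-- **The honest descended representation `[σ, x^a √f^{b+1}/(b+1)]`**. [cite: KontsevichZagier2001, §1.1] -/
def vBaseRep (h : 0 < disc q₂ q₃) (a b : ℕ) : IntegralRep 1 where
  domain := oval q₂ q₃
  integrand := fun p => p 0 ^ a * Real.sqrt (cubic q₂ q₃ (p 0)) ^ (b + 1) / ((b : ℝ) + 1)
  isSemialgebraic_domain := isSemialgebraic_oval h
  isSemialgebraicFunOn_integrand := isSemialgebraicFunOn_descended h a b
  integrableOn := integrableOn_descended h a b

/-- **Vertical descent is ONE legal Newton–Leibniz move, for every admissible parameter and every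
moment**: `[vBand, x^a y^b] − [σ, x^a √f^{b+1}/(b+1)] ∈ KZ.newtonLeibnizRel`, with base the OPEN
oval `σ`, bounds `a(x) = 0 ≤ b(x) = √f(x)` (both `ℚ`-semialgebraic on `σ`), polynomial primitive
`F(x, y) = x^a y^{b+1}/(b+1)` (semialgebraic on the band, continuous on each closed fibre, with
`∂F/∂y = x^a y^b` on the open fibre) and `F(x, √f) − F(x, 0) = x^a √f^{b+1}/(b+1)`. This is the
rule-3 half of `stub_verticalDescent` (the other half is one (1a) move across the two null graphs
`y = 0`, `y = √f(x)` separating the closed band from the open `D`). [cite: KontsevichZagier2001, §1.2 rule (3)] -/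
theorem of_vBandRep_sub_of_vBaseRep_mem_newtonLeibnizRel (h : 0 < disc q₂ q₃) (a b : ℕ) :
    KZ.of (vBandRep h a b) - KZ.of (vBaseRep h a b) ∈ newtonLeibnizRel := by
  have hs := isSemialgebraic_oval h
  refine ⟨1, vBandRep h a b, vBaseRep h a b, fun _ => 0, sqrtCubic q₂ q₃,
    fun z => z 0 ^ a * z 1 ^ (b + 1) / ((b : ℝ) + 1), ?_, ?_, ?_, ?_, rfl, ?_, ?_, ?_, rfl⟩
  · -- `F` is semialgebraic on the band (a `ℚ`-polynomial)
    refine (isSemialgebraicFunOn_aeval (isSemialgebraic_vBand h)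
      (C (1 / ((b : ℚ) + 1)) * X 0 ^ a * X 1 ^ (b + 1) : MvPolynomial (Fin 2) ℚ)).congr fun z _ => ?_
    simp only [map_mul, map_pow, MvPolynomial.aeval_X, MvPolynomial.aeval_C, eq_ratCast]
    push_cast
    ring
  · -- `a = 0` is semialgebraic on `σ`
    exact (isSemialgebraicFunOn_aeval hs (0 : MvPolynomial (Fin 1) ℚ)).congr fun _ _ => by simp
  · -- `b = √f` is semialgebraic on `σ`
    have := IsSemialgebraicFunOn.sqrt_holds (isSemialgebraicFunOn_aeval hs (cubicPolyQ q₂ q₃))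
    exact this.congr fun p _ => by simp [aeval_cubicPolyQ, sqrtCubic]
  · -- `a ≤ b`
    intro x _
    exact Real.sqrt_nonneg _
  · -- continuity of `t ↦ F (x, t)` on the closed fibre
    intro x _
    show ContinuousOn (fun t : ℝ => (Fin.snoc x t : Fin 2 → ℝ) 0 ^ a *
      (Fin.snoc x t : Fin 2 → ℝ) 1 ^ (b + 1) / ((b : ℝ) + 1)) _
    simp only [snoc₂_apply_zero, snoc₂_apply_one]
    fun_prop
  · -- derivative on the open fibre
    intro x _ t _
    show HasDerivAt (fun s : ℝ => (Fin.snoc x s : Fin 2 → ℝ) 0 ^ a *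
      (Fin.snoc x s : Fin 2 → ℝ) 1 ^ (b + 1) / ((b : ℝ) + 1))
      ((Fin.snoc x t : Fin 2 → ℝ) 0 ^ a * (Fin.snoc x t : Fin 2 → ℝ) 1 ^ b) t
    simp only [snoc₂_apply_zero, snoc₂_apply_one]
    have hb : ((b : ℝ) + 1) ≠ 0 := by positivity
    have h1 : HasDerivAt (fun s : ℝ => s ^ (b + 1)) (((b + 1 : ℕ) : ℝ) * t ^ b) t := by
      simpa using hasDerivAt_pow (b + 1) t
    have h2 := (h1.const_mul (x 0 ^ a)).div_const ((b : ℝ) + 1)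
    have key : x 0 ^ a * (((b + 1 : ℕ) : ℝ) * t ^ b) / ((b : ℝ) + 1) = x 0 ^ a * t ^ b := by
      rw [Nat.cast_succ, mul_div_assoc, mul_div_cancel_left₀ _ hb]
    rw [key] at h2
    exact h2
  · -- boundary values
    intro x _
    show x 0 ^ a * Real.sqrt (cubic q₂ q₃ (x 0)) ^ (b + 1) / ((b : ℝ) + 1) =
      (Fin.snoc x (sqrtCubic q₂ q₃ x) : Fin 2 → ℝ) 0 ^ a *
        (Fin.snoc x (sqrtCubic q₂ q₃ x) : Fin 2 → ℝ) 1 ^ (b + 1) / ((b : ℝ) + 1) -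
      (Fin.snoc x ((fun _ => (0 : ℝ)) x) : Fin 2 → ℝ) 0 ^ a *
        (Fin.snoc x ((fun _ => (0 : ℝ)) x) : Fin 2 → ℝ) 1 ^ (b + 1) / ((b : ℝ) + 1)
    simp only [snoc₂_apply_zero, snoc₂_apply_one, sqrtCubic]
    rw [zero_pow (Nat.succ_ne_zero b)]
    ring

/-- Hence `[vBand, x^a y^b] ~ [σ, x^a √f^{b+1}/(b+1)]`. [cite: KontsevichZagier2001, §1.2 rule (3)] -/
theorem of_vBandRep_sub_of_vBaseRep_mem_relations (h : 0 < disc q₂ q₃) (a b : ℕ) :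
    KZ.of (vBandRep h a b) - KZ.of (vBaseRep h a b) ∈ relations :=
  newtonLeibnizRel_subset_relations (of_vBandRep_sub_of_vBaseRep_mem_newtonLeibnizRel h a b)

end VerticalDescent

end Summit.KontsevichZagierPeriods.HermiteRigidity.EllipticMomentKernelNegative
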